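import Mathlib
import Summits.ValiantsHypothesis.ValiantsHypothesis.Theorems.NewtonUnitEquationsNewtonTauWeakSumsetChartCount

/-!
# Median-layer splitting of a `c`-core design (crux `NewtonTauWeak`, three-bin law task)

A `c`-core design is `h : Fin c → Finset (Fin x) → ℕ²`; a configuration `f : Fin x → Fin c` read through
`V ⊆ Fin x` with allowed bins `D ⊆ Fin c` and offset `a` has the point `a + Σ_{d ∈ D} h d (V ∩ f⁻¹ d)`.
MEDIAN DATUM of `f`: the least bin `m` with `|V ∩ f⁻¹{≤ m}| ≥ k` (`k = ⌈|V|/2⌉`), `T = V ∩ f⁻¹{< m}`,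
`T' = V ∩ f⁻¹{≤ m}`.  Given the datum, the configurations form a product (bins `< m` on `T`) × (bin `m` gets
`T' \ T`) × (bins `> m` on `V \ T'`), so the slice cloud is a planar Minkowski sum of two sub-design clouds on at
most `⌊|V|/2⌋` elements each; the chart lemma for sumsets (`stub_sumsetChartCount`) then bounds the lower-hull
vertices of the whole cloud by the sum over the `≤ c·3^{|V|}` data of the two sub-clouds' counts
(`chart_ncard_le_sum_data`).  Iterated (file `…MedianBound`), this gives per-element base `≤ 9` uniformly in `c`.
-/

-- Sub = Summit single-conjunct layout: the duplicated namespace component is mandated by the tree.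
set_option linter.dupNamespace false

open scoped BigOperators

namespace Summit.ValiantsHypothesis.ValiantsHypothesis.Theorems.NewtonUnitEquationsNewtonTauWeak

namespace MedianSplittingAux

variable {x c : ℕ}

section Fibres

variable {m : Fin c} {T T' V : Finset (Fin x)} {g f₁ f₂ : Fin x → Fin c}

/-- FIBRES of a configuration `g` glued along a datum `(m, T, T')`: a bin `d < m` receives `T ∩ f₁⁻¹ d`. [folklore] -/
theorem fibre_lt (hTT' : T ⊆ T') (hT'V : T' ⊆ V)
    (hgT : ∀ u ∈ T, g u = f₁ u ∧ f₁ u < m) (hgM : ∀ u ∈ T', u ∉ T → g u = m)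
    (hgR : ∀ u ∈ V, u ∉ T' → g u = f₂ u ∧ m < f₂ u) {d : Fin c} (hd : d < m) :
    (V ∩ Finset.univ.filter fun u => g u = d) = T ∩ Finset.univ.filter fun u => f₁ u = d := by
  ext u
  simp only [Finset.mem_inter, Finset.mem_filter, Finset.mem_univ, true_and]
  constructor
  · rintro ⟨huV, hgu⟩
    by_cases huT : u ∈ T
    · exact ⟨huT, by rw [← (hgT u huT).1]; exact hgu⟩
    · exfalso
      by_cases huT' : u ∈ T'
      · have hm : g u = m := hgM u huT' huT
        rw [hgu] at hm
        exact absurd hd (by rw [hm]; exact lt_irrefl _)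
      · obtain ⟨hg, hlt⟩ := hgR u huV huT'
        rw [hgu] at hg
        rw [← hg] at hlt
        exact absurd (hd.trans hlt) (lt_irrefl _)
  · rintro ⟨huT, hfu⟩
    exact ⟨hT'V (hTT' huT), by rw [(hgT u huT).1, hfu]⟩

/-- FIBRES of a glued configuration: the median bin `m` receives `T' \ T`. [folklore] -/
theorem fibre_eq (hT'V : T' ⊆ V)
    (hgT : ∀ u ∈ T, g u = f₁ u ∧ f₁ u < m) (hgM : ∀ u ∈ T', u ∉ T → g u = m)
    (hgR : ∀ u ∈ V, u ∉ T' → g u = f₂ u ∧ m < f₂ u) :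
    (V ∩ Finset.univ.filter fun u => g u = m) = T' \ T := by
  ext u
  simp only [Finset.mem_inter, Finset.mem_filter, Finset.mem_univ, true_and, Finset.mem_sdiff]
  constructor
  · rintro ⟨huV, hgu⟩
    by_cases huT : u ∈ T
    · exfalso
      obtain ⟨hg, hlt⟩ := hgT u huT
      rw [hgu] at hg
      rw [← hg] at hlt
      exact lt_irrefl _ hlt
    · by_cases huT' : u ∈ T'
      · exact ⟨huT', huT⟩
      · exfalso
        obtain ⟨hg, hlt⟩ := hgR u huV huT'
        rw [hgu] at hg
        rw [← hg] at hlt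
        exact lt_irrefl _ hlt
  · rintro ⟨huT', huT⟩
    exact ⟨hT'V huT', hgM u huT' huT⟩

/-- FIBRES of a glued configuration: a bin `d > m` receives `(V \ T') ∩ f₂⁻¹ d`. [folklore] -/
theorem fibre_gt
    (hgT : ∀ u ∈ T, g u = f₁ u ∧ f₁ u < m) (hgM : ∀ u ∈ T', u ∉ T → g u = m)
    (hgR : ∀ u ∈ V, u ∉ T' → g u = f₂ u ∧ m < f₂ u) {d : Fin c} (hd : m < d) :
    (V ∩ Finset.univ.filter fun u => g u = d) = (V \ T') ∩ Finset.univ.filter fun u => f₂ u = d := by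
  ext u
  simp only [Finset.mem_inter, Finset.mem_filter, Finset.mem_univ, true_and, Finset.mem_sdiff]
  constructor
  · rintro ⟨huV, hgu⟩
    by_cases huT : u ∈ T
    · exfalso
      obtain ⟨hg, hlt⟩ := hgT u huT
      rw [hgu] at hg
      rw [← hg] at hlt
      exact absurd (hlt.trans hd) (lt_irrefl _)
    · by_cases huT' : u ∈ T'
      · exfalso
        have hm : g u = m := hgM u huT' huT
        rw [hgu] at hm
        exact absurd hd (by rw [hm]; exact lt_irrefl _)
      · exact ⟨⟨huV, huT'⟩, by rw [← (hgR u huV huT').1]; exact hgu⟩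
  · rintro ⟨⟨huV, huT'⟩, hfu⟩
    exact ⟨huV, by rw [(hgR u huV huT').1, hfu]⟩

/-- GLUED POINT: split `Σ_{d ∈ D}` at the median bin `m ∈ D` and read the three kinds of fibres. [folklore] -/
theorem sum_glue (h : Fin c → Finset (Fin x) → (Fin 2 →₀ ℕ)) {D : Finset (Fin c)} (hmD : m ∈ D)
    (hTT' : T ⊆ T') (hT'V : T' ⊆ V)
    (hgT : ∀ u ∈ T, g u = f₁ u ∧ f₁ u < m) (hgM : ∀ u ∈ T', u ∉ T → g u = m)
    (hgR : ∀ u ∈ V, u ∉ T' → g u = f₂ u ∧ m < f₂ u) (a : Fin 2 →₀ ℕ) :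
    a + ∑ d ∈ D, h d (V ∩ Finset.univ.filter fun u => g u = d) =
      (a + h m (T' \ T) + ∑ d ∈ D.filter (fun d => d < m), h d (T ∩ Finset.univ.filter fun u => f₁ u = d)) +
        ∑ d ∈ D.filter (fun d => m < d), h d ((V \ T') ∩ Finset.univ.filter fun u => f₂ u = d) := by
  have hsplit : D.filter (fun d => ¬ d < m) = insert m (D.filter fun d => m < d) := by
    ext d
    simp only [Finset.mem_filter, Finset.mem_insert, not_lt]
    constructor
    · rintro ⟨hdD, hmd⟩
      rcases hmd.lt_or_eq with hlt | heq
      · exact Or.inr ⟨hdD, hlt⟩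
      · exact Or.inl heq.symm
    · rintro (rfl | ⟨hdD, hlt⟩)
      · exact ⟨hmD, le_rfl⟩
      · exact ⟨hdD, hlt.le⟩
  have hnot : m ∉ D.filter (fun d => m < d) := by simp
  have hA : ∑ d ∈ D.filter (fun d => d < m), h d (V ∩ Finset.univ.filter fun u => g u = d) =
      ∑ d ∈ D.filter (fun d => d < m), h d (T ∩ Finset.univ.filter fun u => f₁ u = d) :=
    Finset.sum_congr rfl fun d hd => by rw [fibre_lt hTT' hT'V hgT hgM hgR (Finset.mem_filter.mp hd).2]
  have hB : ∑ d ∈ D.filter (fun d => m < d), h d (V ∩ Finset.univ.filter fun u => g u = d) =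
      ∑ d ∈ D.filter (fun d => m < d), h d ((V \ T') ∩ Finset.univ.filter fun u => f₂ u = d) :=
    Finset.sum_congr rfl fun d hd => by rw [fibre_gt hgT hgM hgR (Finset.mem_filter.mp hd).2]
  rw [← Finset.sum_filter_add_sum_filter_not D (fun d => d < m), hsplit, Finset.sum_insert hnot,
    fibre_eq hT'V hgT hgM hgR, hA, hB]
  abel

end Fibres

/-- GLUING: a prefix configuration `f₁` (bins `< m` of `D` on `T`) and a suffix configuration `f₂` (bins `> m` of `D`
on `V \ T'`) glue, with bin `m` on `T' \ T`, to a configuration with bins in `D` on `V` whose point is the sum of the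
prefix point (offset `a + h m (T' \ T)`) and the suffix point. [folklore] -/
theorem glue_point (h : Fin c → Finset (Fin x) → (Fin 2 →₀ ℕ)) {D : Finset (Fin c)} {m : Fin c} (hmD : m ∈ D)
    {T T' V : Finset (Fin x)} (hTT' : T ⊆ T') (hT'V : T' ⊆ V) {f₁ f₂ : Fin x → Fin c}
    (hf₁ : ∀ u ∈ T, f₁ u ∈ D.filter fun d => d < m) (hf₂ : ∀ u ∈ V \ T', f₂ u ∈ D.filter fun d => m < d)
    (a : Fin 2 →₀ ℕ) :
    ∃ g : Fin x → Fin c, (∀ u ∈ V, g u ∈ D) ∧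
      a + ∑ d ∈ D, h d (V ∩ Finset.univ.filter fun u => g u = d) =
        (a + h m (T' \ T) + ∑ d ∈ D.filter (fun d => d < m), h d (T ∩ Finset.univ.filter fun u => f₁ u = d)) +
          ∑ d ∈ D.filter (fun d => m < d), h d ((V \ T') ∩ Finset.univ.filter fun u => f₂ u = d) := by
  have hf₁' : ∀ u ∈ T, f₁ u ∈ D ∧ f₁ u < m := fun u hu => Finset.mem_filter.mp (hf₁ u hu)
  have hf₂' : ∀ u ∈ V, u ∉ T' → f₂ u ∈ D ∧ m < f₂ u := fun u hu hu' =>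
    Finset.mem_filter.mp (hf₂ u (Finset.mem_sdiff.mpr ⟨hu, hu'⟩))
  refine ⟨fun u => if u ∈ T then f₁ u else if u ∈ T' then m else f₂ u, fun u huV => ?_, ?_⟩
  · by_cases huT : u ∈ T
    · simp only [huT, ↓reduceIte]
      exact (hf₁' u huT).1
    · by_cases huT' : u ∈ T'
      · simp only [huT, ↓reduceIte, huT']
        exact hmD
      · simp only [huT, ↓reduceIte, huT']
        exact (hf₂' u huV huT').1
  · refine sum_glue h hmD hTT' hT'V (g := fun u => if u ∈ T then f₁ u else if u ∈ T' then m else f₂ u)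
      (fun u huT => ⟨by simp only [huT, ↓reduceIte], (hf₁' u huT).2⟩)
      (fun u huT' huT => by simp only [huT, ↓reduceIte, huT'])
      (fun u huV huT' => ⟨?_, (hf₂' u huV huT').2⟩) a
    have huT : u ∉ T := fun huT => huT' (hTT' huT)
    simp only [huT, ↓reduceIte, huT']

/-- MEDIAN BIN: for `1 ≤ k ≤ |V|` some bin `m` in the range of `f` on `V` has `|V ∩ f⁻¹{< m}| < k ≤ |V ∩ f⁻¹{≤ m}|`
(the least bin whose lower set reaches `k`). [folklore] -/
theorem exists_median (f : Fin x → Fin c) (V : Finset (Fin x)) {k : ℕ} (hk : 1 ≤ k) (hkV : k ≤ V.card) :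
    ∃ m : Fin c, (∃ u ∈ V, f u = m) ∧ (V.filter fun u => f u < m).card < k ∧
      k ≤ (V.filter fun u => f u ≤ m).card := by
  classical
  have hVne : V.Nonempty := Finset.card_pos.mp (lt_of_lt_of_le hk hkV)
  -- the bins whose lower set reaches `k`; the top of the range of `f` on `V` is one of them
  obtain ⟨M, hM⟩ : ∃ M : Finset (Fin c), ∀ m, m ∈ M ↔ k ≤ (V.filter fun u => f u ≤ m).card :=
    ⟨Finset.univ.filter fun m => k ≤ (V.filter fun u => f u ≤ m).card, fun m => by simp⟩
  have hM₁ : V.sup' hVne f ∈ M := by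
    rw [hM]
    refine hkV.trans (le_of_eq (congrArg Finset.card ?_).symm)
    exact Finset.filter_true_of_mem fun u hu => Finset.le_sup' f hu
  have hMne : M.Nonempty := ⟨_, hM₁⟩
  have hkm : k ≤ (V.filter fun u => f u ≤ M.min' hMne).card := (hM _).mp (Finset.min'_mem M hMne)
  -- the strict lower set of the least such bin is short of `k`: else its top would be a smaller member of `M`
  have hTlt : (V.filter fun u => f u < M.min' hMne).card < k := by
    by_contra hge
    rw [not_lt] at hge
    have hTne : (V.filter fun u => f u < M.min' hMne).Nonempty := Finset.card_pos.mp (lt_of_lt_of_le hk hge)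
    obtain ⟨u, hu, hsup⟩ := Finset.exists_mem_eq_sup' hTne f
    have hmem : (V.filter fun u => f u < M.min' hMne).sup' hTne f ∈ M := by
      rw [hM]
      refine hge.trans (Finset.card_le_card fun v hv => ?_)
      rw [Finset.mem_filter] at hv ⊢
      exact ⟨hv.1, Finset.le_sup' f (Finset.mem_filter.mpr hv)⟩
    have hle : M.min' hMne ≤ (V.filter fun u => f u < M.min' hMne).sup' hTne f := Finset.min'_le M _ hmem
    rw [hsup] at hle
    exact absurd (Finset.mem_filter.mp hu).2 (not_lt.mpr hle)
  refine ⟨M.min' hMne, ?_, hTlt, hkm⟩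
  -- the least such bin is attained on `V`: its lower set is strictly bigger than its strict lower set
  by_contra hno
  have hsub : (V.filter fun u => f u ≤ M.min' hMne) ⊆ V.filter fun u => f u < M.min' hMne := by
    intro u hu
    rw [Finset.mem_filter] at hu ⊢
    exact ⟨hu.1, lt_of_le_of_ne hu.2 fun heq => hno ⟨u, hu.1, heq⟩⟩
  exact absurd (hkm.trans (Finset.card_le_card hsub)) (not_le.mpr hTlt)

/-- ABSTRACT SLICE BOUND: if a finite planar cloud `S` is covered by sumsets `A i ⊕ B i` (`i ∈ I`) all of whose points
lie in `S`, then the chart points (`σ = -1`, lower-hull vertices) of `S` number at most `Σ_{i ∈ I} (|U(A i)| + |U(B i)|)`: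
a chart point of `S` is a chart point of the sumset of its own slice, and the chart lemma for planar sumsets
(`stub_sumsetChartCount`) bounds each slice. [folklore] -/
theorem chart_ncard_le_sum_data {ι : Type*} (S : Finset (Fin 2 →₀ ℕ)) (I : Finset ι)
    (A B : ι → Finset (Fin 2 →₀ ℕ))
    (hvalid : ∀ i ∈ I, ∀ p ∈ A i, ∀ q ∈ B i, p + q ∈ S)
    (hcover : ∀ z ∈ S, ∃ i ∈ I, ∃ p ∈ A i, ∃ q ∈ B i, p + q = z) :
    {z : Fin 2 →₀ ℕ | z ∈ S ∧ ∃ t : ℝ, ∀ z' ∈ S, z' ≠ z →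
        t * ((z' 0 : ℕ) : ℝ) + (-1) * ((z' 1 : ℕ) : ℝ) < t * ((z 0 : ℕ) : ℝ) + (-1) * ((z 1 : ℕ) : ℝ)}.ncard ≤
      ∑ i ∈ I, ({p : Fin 2 →₀ ℕ | p ∈ A i ∧ ∃ t : ℝ, ∀ q ∈ A i, q ≠ p →
          t * ((q 0 : ℕ) : ℝ) + (-1) * ((q 1 : ℕ) : ℝ) < t * ((p 0 : ℕ) : ℝ) + (-1) * ((p 1 : ℕ) : ℝ)}.ncard +
        {p : Fin 2 →₀ ℕ | p ∈ B i ∧ ∃ t : ℝ, ∀ q ∈ B i, q ≠ p →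
          t * ((q 0 : ℕ) : ℝ) + (-1) * ((q 1 : ℕ) : ℝ) < t * ((p 0 : ℕ) : ℝ) + (-1) * ((p 1 : ℕ) : ℝ)}.ncard) := by
  classical
  -- the chart set of the sumset of slice `i`
  obtain ⟨U, hU⟩ : ∃ U : ι → Set (Fin 2 →₀ ℕ), ∀ i, U i =
      {p : Fin 2 →₀ ℕ | p ∈ (A i ×ˢ B i).image (fun pq : (Fin 2 →₀ ℕ) × (Fin 2 →₀ ℕ) => pq.1 + pq.2) ∧
        ∃ t : ℝ, ∀ q ∈ (A i ×ˢ B i).image (fun pq : (Fin 2 →₀ ℕ) × (Fin 2 →₀ ℕ) => pq.1 + pq.2), q ≠ p →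
          t * ((q 0 : ℕ) : ℝ) + (-1) * ((q 1 : ℕ) : ℝ) < t * ((p 0 : ℕ) : ℝ) + (-1) * ((p 1 : ℕ) : ℝ)} :=
    ⟨_, fun _ => rfl⟩
  -- every point of a slice sumset is a point of `S`
  have hsub : ∀ i ∈ I, ∀ q ∈ (A i ×ˢ B i).image (fun pq : (Fin 2 →₀ ℕ) × (Fin 2 →₀ ℕ) => pq.1 + pq.2),
      q ∈ S := by
    intro i hi z hz
    obtain ⟨p, hp, q, hq, rfl⟩ := SumsetChartCountAux.mem_sumset_iff.mp hz
    exact hvalid i hi p hp q hq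
  -- a chart point of `S` is a chart point (same `t`) of the sumset of its own slice
  have hcov : {z : Fin 2 →₀ ℕ | z ∈ S ∧ ∃ t : ℝ, ∀ z' ∈ S, z' ≠ z →
      t * ((z' 0 : ℕ) : ℝ) + (-1) * ((z' 1 : ℕ) : ℝ) < t * ((z 0 : ℕ) : ℝ) + (-1) * ((z 1 : ℕ) : ℝ)} ⊆
      ⋃ i ∈ I, U i := by
    rintro z ⟨hz, t, ht⟩
    obtain ⟨i, hi, p, hp, q, hq, rfl⟩ := hcover z hz
    refine Set.mem_iUnion₂.mpr ⟨i, hi, ?_⟩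
    rw [hU, Set.mem_setOf_eq]
    exact ⟨SumsetChartCountAux.add_mem_sumset hp hq, t, fun z' hz' hne => ht z' (hsub i hi z' hz') hne⟩
  have hfin : (⋃ i ∈ I, U i).Finite := S.finite_toSet.subset fun p hp => by
    obtain ⟨i, hi, hp⟩ := Set.mem_iUnion₂.mp hp
    rw [hU] at hp
    exact hsub i hi p hp.1
  refine ((Set.ncard_le_ncard hcov hfin).trans (Finset.set_ncard_biUnion_le I U)).trans
    (Finset.sum_le_sum fun i _ => ?_)
  -- per slice: an empty factor gives an empty sumset; otherwise the chart lemma for planar sumsets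
  rcases (A i).eq_empty_or_nonempty with hA | hA
  · have hempty : U i = ∅ := by
      rw [hU]
      ext p
      simp [hA]
    rw [hempty, Set.ncard_empty]
    exact Nat.zero_le _
  rcases (B i).eq_empty_or_nonempty with hB | hB
  · have hempty : U i = ∅ := by
      rw [hU]
      ext p
      simp [hB]
    rw [hempty, Set.ncard_empty]
    exact Nat.zero_le _
  rw [hU]
  exact Nat.le_of_succ_le (stub_sumsetChartCount (-1) (by norm_num) (A i) (B i) hA hB)

/-- **MEDIAN-LAYER SPLITTING (the recursion).**  For a design `h` read through `V` with allowed bins `D` and offset `a`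
(cloud `cl D V a`), and `1 ≤ k ≤ |V|`: the chart points of the cloud number at most the sum, over the data
`σ = (m, T, T')` with `m ∈ D`, `T ⊆ T' ⊆ V`, `|T| < k ≤ |T'|`, of the chart-point counts of the PREFIX cloud (bins `< m`
of `D` read through `T`, offset `a + h m (T' \ T)`) and of the SUFFIX cloud (bins `> m` of `D` read through `V \ T'`).
Slice = Minkowski sum of prefix and suffix (`glue_point`, `sum_glue`); every configuration lies in the slice of its
median datum (`exists_median`); conclude with `chart_ncard_le_sum_data`. [folklore] -/
theorem chart_ncard_le_sum_median (h : Fin c → Finset (Fin x) → (Fin 2 →₀ ℕ))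
    (cl : Finset (Fin c) → Finset (Fin x) → (Fin 2 →₀ ℕ) → Finset (Fin 2 →₀ ℕ))
    (hcl : ∀ D V a, cl D V a = ((Finset.univ.filter fun f : Fin x → Fin c => ∀ u ∈ V, f u ∈ D).image
        fun f => a + ∑ d ∈ D, h d (V ∩ Finset.univ.filter fun u => f u = d)))
    (ch : Finset (Fin 2 →₀ ℕ) → Set (Fin 2 →₀ ℕ))
    (hch : ∀ S, ch S = {p : Fin 2 →₀ ℕ | p ∈ S ∧ ∃ t : ℝ, ∀ q ∈ S, q ≠ p →
        t * ((q 0 : ℕ) : ℝ) + (-1) * ((q 1 : ℕ) : ℝ) < t * ((p 0 : ℕ) : ℝ) + (-1) * ((p 1 : ℕ) : ℝ)})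
    (D : Finset (Fin c)) (V : Finset (Fin x)) (a : Fin 2 →₀ ℕ) {k : ℕ} (hk : 1 ≤ k) (hkV : k ≤ V.card) :
    (ch (cl D V a)).ncard ≤
      ∑ σ ∈ (Finset.univ ×ˢ V.powerset.biUnion fun T' => T'.powerset.image fun T => (T, T')).filter
          (fun σ : Fin c × (Finset (Fin x) × Finset (Fin x)) => σ.1 ∈ D ∧ σ.2.1.card < k ∧ k ≤ σ.2.2.card),
        ((ch (cl (D.filter fun d => d < σ.1) σ.2.1 (a + h σ.1 (σ.2.2 \ σ.2.1)))).ncard +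
          (ch (cl (D.filter fun d => σ.1 < d) (V \ σ.2.2) 0)).ncard) := by
  classical
  simp only [hch]
  refine chart_ncard_le_sum_data (cl D V a) _
    (fun σ : Fin c × (Finset (Fin x) × Finset (Fin x)) => cl (D.filter fun d => d < σ.1) σ.2.1
      (a + h σ.1 (σ.2.2 \ σ.2.1)))
    (fun σ : Fin c × (Finset (Fin x) × Finset (Fin x)) => cl (D.filter fun d => σ.1 < d) (V \ σ.2.2) 0)
    ?_ ?_
  · -- VALIDITY: glued configurations are configurations
    rintro ⟨m, T, T'⟩ hσ p hp q hq
    simp only [Finset.mem_filter, Finset.mem_product, Finset.mem_univ, true_and, Finset.mem_biUnion,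
      Finset.mem_powerset, Finset.mem_image, Prod.mk.injEq] at hσ
    obtain ⟨⟨T₂, hT'V, T₁, hTT', hTeq, hT'eq⟩, hmD, -, -⟩ := hσ
    subst hTeq hT'eq
    rw [hcl] at hp hq ⊢
    obtain ⟨f₁, hf₁, rfl⟩ := Finset.mem_image.mp hp
    obtain ⟨f₂, hf₂, rfl⟩ := Finset.mem_image.mp hq
    obtain ⟨g, hgD, hgsum⟩ := glue_point h hmD hTT' hT'V (Finset.mem_filter.mp hf₁).2
      (Finset.mem_filter.mp hf₂).2 a
    refine Finset.mem_image.mpr ⟨g, Finset.mem_filter.mpr ⟨Finset.mem_univ _, hgD⟩, ?_⟩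
    rw [hgsum, zero_add]
  · -- COVERING: every configuration lies in the slice of its median datum
    intro z hz
    rw [hcl] at hz
    obtain ⟨f, hf, rfl⟩ := Finset.mem_image.mp hz
    have hfD : ∀ u ∈ V, f u ∈ D := (Finset.mem_filter.mp hf).2
    obtain ⟨m, ⟨u, huV, hum⟩, hTlt, hkT'⟩ := exists_median f V hk hkV
    set T := V.filter fun u => f u < m with hT
    set T' := V.filter fun u => f u ≤ m with hT'
    have hTT' : T ⊆ T' := fun v hv =>
      Finset.mem_filter.mpr ⟨(Finset.mem_filter.mp hv).1, le_of_lt (Finset.mem_filter.mp hv).2⟩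
    have hT'V : T' ⊆ V := Finset.filter_subset _ _
    have hmD : m ∈ D := hum ▸ hfD u huV
    have hgT : ∀ v ∈ T, f v = f v ∧ f v < m := fun v hv => ⟨rfl, (Finset.mem_filter.mp hv).2⟩
    have hgM : ∀ v ∈ T', v ∉ T → f v = m := fun v hv hv' =>
      le_antisymm (Finset.mem_filter.mp hv).2
        (not_lt.mp fun hlt => hv' (Finset.mem_filter.mpr ⟨(Finset.mem_filter.mp hv).1, hlt⟩))
    have hgR : ∀ v ∈ V, v ∉ T' → f v = f v ∧ m < f v := fun v hv hv' =>
      ⟨rfl, not_le.mp fun hle => hv' (Finset.mem_filter.mpr ⟨hv, hle⟩)⟩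
    refine ⟨(m, T, T'), ?_, a + h m (T' \ T) + ∑ d ∈ D.filter (fun d => d < m),
      h d (T ∩ Finset.univ.filter fun u => f u = d), ?_,
      0 + ∑ d ∈ D.filter (fun d => m < d), h d ((V \ T') ∩ Finset.univ.filter fun u => f u = d), ?_, ?_⟩
    · exact Finset.mem_filter.mpr ⟨Finset.mem_product.mpr ⟨Finset.mem_univ _, Finset.mem_biUnion.mpr
        ⟨T', Finset.mem_powerset.mpr hT'V, Finset.mem_image.mpr ⟨T, Finset.mem_powerset.mpr hTT', rfl⟩⟩⟩,
        hmD, hTlt, hkT'⟩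
    · rw [hcl]
      exact Finset.mem_image.mpr ⟨f, Finset.mem_filter.mpr ⟨Finset.mem_univ _, fun v hv =>
        Finset.mem_filter.mpr ⟨hfD v (hT'V (hTT' hv)), (Finset.mem_filter.mp hv).2⟩⟩, rfl⟩
    · rw [hcl]
      exact Finset.mem_image.mpr ⟨f, Finset.mem_filter.mpr ⟨Finset.mem_univ _, fun v hv =>
        Finset.mem_filter.mpr ⟨hfD v (Finset.mem_sdiff.mp hv).1,
          (hgR v (Finset.mem_sdiff.mp hv).1 (Finset.mem_sdiff.mp hv).2).2⟩⟩, rfl⟩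
    · rw [zero_add]
      exact (sum_glue h hmD hTT' hT'V hgT hgM hgR a).symm

end MedianSplittingAux

end Summit.ValiantsHypothesis.ValiantsHypothesis.Theorems.NewtonUnitEquationsNewtonTauWeak
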